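import Literature.Probability.RandomPlanarGeometry.SelfAvoidingWalk
import Literature.Probability.RandomPlanarGeometry.PolylineDyadicClock
import Literature.Probability.RandomPlanarGeometry.PolylineUniform
import Literature.Probability.RandomPlanarGeometry.LoopSpaceMaps
import Literature.Probability.LatticeModels.PolylinePrefix
import Mathlib.MeasureTheory.Measure.LevyProkhorovMetric
import HarnessLib

/-!
# Screening recursion for `SAWCircleScreening`, part IX: curves that agree after a small ball

Route `SAWCircleScreening` of `CriticalPhenomena/SAWScalingLimit`, support item
`ScreeningRecursion` (stmt-CriticalPhenomena-5468). The coupling produced by the screening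
recursion makes two self-avoiding walks AGREE after their first exits from a small ball
`B(c, R)`; this file converts that into smallness of the distance of their polylines in the
space `CurveClass ℂ` of curves modulo reparametrisation, and then into a Lévy–Prokhorov bound:

* `polyline_cons_append_apply_mem` — after the prefix time `1 - 2^{-|m|}` the dyadic polyline of
  `a :: (m ++ r)` stays in any convex set containing the last prefix vertex and `r`;
* `dist_polyline_le_of_common_prefix` — two polylines with a common prefix, whose remaining
  vertices lie in `B̄(z₀, R)`, are at sup-distance `≤ 2R` (they coincide up to the prefix time);
* `dist_mk_polyline_le_of_common_suffix` — by time reversal (an isometry of `CurveClass`,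
  `reverse_mk_polyline`), the same for a common SUFFIX: classes at distance `≤ 2R`;
* `dist_curve_le_of_common_suffix` — the `DomainSAW.curve` form;
* `levyProkhorovEDist_map_le_of_tail` — **LP from a tail coupling**: if `Φ₁ x₁ = Φ₂ x₂` forces
  `dist (f₁ x₁) (f₂ x₂) ≤ ε₁` and the laws of `Φ₁`, `Φ₂` are `d`-close on all sets, then the
  image laws under `f₁`, `f₂` are at Lévy–Prokhorov distance `≤ max ε₁ d`.

Folklore (Billingsley 1999, Thm 3.1, "converging together"). Tree anchors:
`polyline_cons_append_eqOn`, `polylineFrom_apply_mem_segment_segIdx` (dyadic clock),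
`Polyline.reverse_mk_polyline`, `CurveClass.isometry_reverse`. Mathlib:
`MeasureTheory.levyProkhorovEDist_le_of_forall`, `ContinuousMap.dist_le`.
-/

noncomputable section

open Set Metric MeasureTheory
open scoped unitInterval ENNReal
open Literature.Probability.LatticeModels
open Literature.Probability.RandomPlanarGeometry
open Literature.Probability.RandomPlanarGeometry.Polyline

namespace Summit.CriticalPhenomena.SAWScalingLimit.Theorems.ScreeningRecursion

section Polylines

/-- Vertices of `a :: (m ++ r)` of index `≥ |m|` are the last prefix vertex or vertices of `r`.
[folklore] -/
theorem getElem_cons_append_mem {V : Type*} (a : V) (m r : List V) {i : ℕ} (hi : m.length ≤ i)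
    (hi' : i < (a :: (m ++ r)).length) {B : Set V}
    (hlast : (a :: m).getLast (List.cons_ne_nil a m) ∈ B) (hr : ∀ x ∈ r, x ∈ B) :
    (a :: (m ++ r))[i] ∈ B := by
  have e : a :: (m ++ r) = (a :: m) ++ r := rfl
  simp only [e]
  by_cases h : i < (a :: m).length
  · rw [List.getElem_append_left h]
    have hi2 : i = m.length := by simp at h; omega
    subst hi2
    rw [List.getLast_eq_getElem] at hlast
    simpa using hlast
  · push Not at h
    rw [List.getElem_append_right h]
    exact hr _ (List.getElem_mem _)

variable {V : Type*} [NormedAddCommGroup V] [NormedSpace ℝ V]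

/-- **After the prefix time the polyline stays near the continuation.** For `s ≥ 1 - 2^{-|m|}`
the dyadic polyline of `a :: (m ++ r)` lies in every convex set containing the last prefix
vertex `(a :: m).getLast` and all vertices of `r`. [folklore] -/
theorem polyline_cons_append_apply_mem (a : V) (m r : List V) {s : I}
    (hs : (dyadicTime m.length : ℝ) ≤ s) {B : Set V} (hB : Convex ℝ B)
    (hlast : (a :: m).getLast (List.cons_ne_nil a m) ∈ B) (hr : ∀ x ∈ r, x ∈ B) :
    polyline (a :: (m ++ r)) s ∈ B := by
  set l := m ++ r with hl
  have hn : m.length ≤ l.length := by rw [hl, List.length_append]; omega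
  show (polylineFrom a l).2 s ∈ B
  have hseg : m.length ≤ segIdx l.length s := le_segIdx hn hs
  rcases (segIdx_le l.length s).lt_or_eq with hlt | heq
  · have hmem := polylineFrom_apply_mem_segment_segIdx a l s hlt
    refine hB.segment_subset ?_ ?_ hmem
    · exact getElem_cons_append_mem a m r hseg _ hlast hr
    · exact getElem_cons_append_mem a m r (by omega) _ hlast hr
  · rw [polylineFrom_apply_of_segIdx_eq a l s heq]
    exact getElem_cons_append_mem a m r hn _ hlast hr

/-- **Two polylines with a common prefix and small continuations are uniformly close**: if the
last prefix vertex and all remaining vertices lie in `B̄(z₀, R)`, the sup-distance of the two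
parametrised polylines is `≤ 2R`. [folklore] -/
theorem dist_polyline_le_of_common_prefix (a : V) (m r₁ r₂ : List V) {z₀ : V} {R : ℝ} (hR : 0 ≤ R)
    (hlast : (a :: m).getLast (List.cons_ne_nil a m) ∈ closedBall z₀ R)
    (hr₁ : ∀ x ∈ r₁, x ∈ closedBall z₀ R) (hr₂ : ∀ x ∈ r₂, x ∈ closedBall z₀ R) :
    dist (polyline (a :: (m ++ r₁))) (polyline (a :: (m ++ r₂))) ≤ 2 * R := by
  rw [ContinuousMap.dist_le (by positivity)]
  intro s
  by_cases hs : (s : ℝ) ≤ 1 - (1 / 2) ^ m.length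
  · rw [polyline_cons_append_eqOn a m r₁ r₂ (show s ∈ Iic _ from hs), dist_self]
    positivity
  · push Not at hs
    have hs' : (dyadicTime m.length : ℝ) ≤ s := by rw [coe_dyadicTime]; exact hs.le
    have h1 := polyline_cons_append_apply_mem a m r₁ hs' (convex_closedBall z₀ R) hlast hr₁
    have h2 := polyline_cons_append_apply_mem a m r₂ hs' (convex_closedBall z₀ R) hlast hr₂
    calc dist (polyline (a :: (m ++ r₁)) s) (polyline (a :: (m ++ r₂)) s)
        ≤ dist (polyline (a :: (m ++ r₁)) s) z₀ + dist z₀ (polyline (a :: (m ++ r₂)) s) :=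
          dist_triangle _ _ _
      _ ≤ R + R := add_le_add (mem_closedBall.1 h1) (by rw [dist_comm]; exact mem_closedBall.1 h2)
      _ = 2 * R := by ring

/-- **Common suffix form** (by time reversal, an isometry of curve classes): the classes of the
polylines of `p₁ ++ c` and `p₂ ++ c`, `c ≠ []`, with all vertices of `p₁`, `p₂` and the first
vertex of `c` in `B̄(z₀, R)`, are at distance `≤ 2R`. [folklore] -/
theorem dist_mk_polyline_le_of_common_suffix (p₁ p₂ c : List V) (hc : c ≠ []) {z₀ : V} {R : ℝ}
    (hR : 0 ≤ R) (hhead : c.head hc ∈ closedBall z₀ R)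
    (hp₁ : ∀ x ∈ p₁, x ∈ closedBall z₀ R) (hp₂ : ∀ x ∈ p₂, x ∈ closedBall z₀ R) :
    dist (CurveClass.mk ⟨polyline (p₁ ++ c)⟩) (CurveClass.mk ⟨polyline (p₂ ++ c)⟩) ≤ 2 * R := by
  -- reverse everything
  rw [← CurveClass.isometry_reverse.dist_eq, reverse_mk_polyline, reverse_mk_polyline,
    List.reverse_append, List.reverse_append]
  obtain ⟨a, m, hcm⟩ : ∃ a m, c.reverse = a :: m := by
    cases h : c.reverse with
    | nil => exact absurd (List.reverse_eq_nil_iff.1 h) hc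
    | cons a m => exact ⟨a, m, rfl⟩
  have hlast : (a :: m).getLast (List.cons_ne_nil a m) ∈ closedBall z₀ R := by
    have : (a :: m).getLast (List.cons_ne_nil a m) = c.head hc := by
      simp only [← hcm, List.getLast_reverse]
    rw [this]; exact hhead
  rw [hcm, List.cons_append, List.cons_append]
  change dist (SeparationQuotient.mk _) (SeparationQuotient.mk _) ≤ _
  rw [SeparationQuotient.dist_mk]
  refine (Curve.dist_le_dist_toContinuousMap _ _).trans ?_
  exact dist_polyline_le_of_common_prefix a m p₁.reverse p₂.reverse hR hlast
    (fun x hx => hp₁ x (List.mem_reverse.1 hx)) (fun x hx => hp₂ x (List.mem_reverse.1 hx))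

end Polylines

/-! ## Self-avoiding walks agreeing after a small ball -/

/-- **Walks agreeing after a small ball have close curves.** Two SAWs (possibly of different
discrete domains, from different starting points) whose supports are `pfx₁ ++ common` and
`pfx₂ ++ common` with `common ≠ []`, all vertices of `pfx₁`, `pfx₂` and the first vertex of
`common` having mesh points in `B̄(z₀, R)`, have curve classes at distance `≤ 2R`. [folklore] -/
theorem dist_curve_le_of_common_suffix {Ω Ω' : Set ℂ} {δ : ℝ} {a₁ a₂ b₁ b₂ : Site 2}
    (γ₁ : SAW.DomainSAW Ω δ a₁ b₁) (γ₂ : SAW.DomainSAW Ω' δ a₂ b₂) (pfx₁ pfx₂ common : List (Site 2))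
    (h₁ : γ₁.walk.support = pfx₁ ++ common) (h₂ : γ₂.walk.support = pfx₂ ++ common)
    (hc : common ≠ []) {z₀ : ℂ} {R : ℝ} (hR : 0 ≤ R)
    (hhead : meshPoint δ (common.head hc) ∈ closedBall z₀ R)
    (hp₁ : ∀ x ∈ pfx₁, meshPoint δ x ∈ closedBall z₀ R)
    (hp₂ : ∀ x ∈ pfx₂, meshPoint δ x ∈ closedBall z₀ R) :
    dist γ₁.curve γ₂.curve ≤ 2 * R := by
  have e₁ : γ₁.curve = CurveClass.mk ⟨polyline ((pfx₁.map (meshPoint δ)) ++ common.map (meshPoint δ))⟩ := by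
    simp only [SAW.DomainSAW.curve, SimpleGraph.Walk.toCurve, h₁, List.map_append]
  have e₂ : γ₂.curve = CurveClass.mk ⟨polyline ((pfx₂.map (meshPoint δ)) ++ common.map (meshPoint δ))⟩ := by
    simp only [SAW.DomainSAW.curve, SimpleGraph.Walk.toCurve, h₂, List.map_append]
  rw [e₁, e₂]
  have hc' : common.map (meshPoint δ) ≠ [] := by simpa using hc
  refine dist_mk_polyline_le_of_common_suffix (z₀ := z₀) _ _ _ hc' hR ?_ ?_ ?_
  · rw [List.head_map]; exact hhead
  · intro x hx; obtain ⟨y, hy, rfl⟩ := List.mem_map.1 hx; exact hp₁ y hy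
  · intro x hx; obtain ⟨y, hy, rfl⟩ := List.mem_map.1 hx; exact hp₂ y hy

/-! ## Lévy–Prokhorov distance from a tail coupling -/

/-- If equal tails force `ε₁`-close images, then the tail-saturation of `g₁ ⁻¹ B` is mapped by
`g₂` into the `ε`-thickening of `B` for every `ε > ε₁`. [folklore] -/
theorem preimage_image_subset_preimage_thickening {Y₁ Y₂ Z E : Type*} [PseudoEMetricSpace E]
    (g₁ : Y₁ → E) (g₂ : Y₂ → E) (Ψ₁ : Y₁ → Z) (Ψ₂ : Y₂ → Z) {ε₁ ε : ℝ≥0∞}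
    (hcl : ∀ y₁ y₂, Ψ₁ y₁ = Ψ₂ y₂ → edist (g₁ y₁) (g₂ y₂) ≤ ε₁) (hε : ε₁ < ε) (hεtop : ε < ⊤)
    (B : Set E) : Ψ₂ ⁻¹' (Ψ₁ '' (g₁ ⁻¹' B)) ⊆ g₂ ⁻¹' (thickening ε.toReal B) := by
  intro y₂ hy₂
  obtain ⟨y₁, hy₁, heq⟩ := hy₂
  rw [mem_preimage, mem_thickening_iff_infEDist_lt]
  have h1 : infEDist (g₂ y₂) B ≤ edist (g₂ y₂) (g₁ y₁) := infEDist_le_edist_of_mem hy₁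
  have h2 : edist (g₁ y₁) (g₂ y₂) ≤ ε₁ := hcl y₁ y₂ heq
  rw [edist_comm] at h2
  calc infEDist (g₂ y₂) B ≤ ε₁ := h1.trans h2
    _ < ENNReal.ofReal ε.toReal := by rwa [ENNReal.ofReal_toReal hεtop.ne]

/-- **LP from a tail comparison.** Let `P₁`, `P₂` be measures on `X₁`, `X₂` (everything
measurable: discrete σ-algebras in our use), `f₁, f₂` maps into a pseudo-emetric space and
`Φ₁, Φ₂` "tail" maps into a common type such that equal tails force `ε₁`-close images. If the
laws of the tails are `d`-close on ALL sets (`P₁ (Φ₁ ⁻¹ A) ≤ P₂ (Φ₂ ⁻¹ A) + d` and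
symmetrically), then `LP(P₁ ∘ f₁⁻¹, P₂ ∘ f₂⁻¹) ≤ max ε₁ d`. [folklore] -/
theorem levyProkhorovEDist_map_le_of_tail {X₁ X₂ Z E : Type*} [MeasurableSpace X₁]
    [MeasurableSpace X₂] [MeasurableSpace E] [PseudoEMetricSpace E] [OpensMeasurableSpace E]
    (P₁ : Measure X₁) (P₂ : Measure X₂) {f₁ : X₁ → E} {f₂ : X₂ → E} (hf₁ : Measurable f₁)
    (hf₂ : Measurable f₂) (Φ₁ : X₁ → Z) (Φ₂ : X₂ → Z) {ε₁ : ℝ≥0∞}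
    (hclose : ∀ x₁ x₂, Φ₁ x₁ = Φ₂ x₂ → edist (f₁ x₁) (f₂ x₂) ≤ ε₁) {d : ℝ≥0∞}
    (h₁₂ : ∀ A : Set Z, P₁ (Φ₁ ⁻¹' A) ≤ P₂ (Φ₂ ⁻¹' A) + d)
    (h₂₁ : ∀ A : Set Z, P₂ (Φ₂ ⁻¹' A) ≤ P₁ (Φ₁ ⁻¹' A) + d) :
    levyProkhorovEDist (P₁.map f₁) (P₂.map f₂) ≤ max ε₁ d := by
  refine levyProkhorovEDist_le_of_forall _ _ _ fun ε B hε hεtop hB => ?_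
  have hε₁ : ε₁ < ε := lt_of_le_of_lt (le_max_left _ _) hε
  have hd : d ≤ ε := (le_max_right _ _).trans hε.le
  have hthick : MeasurableSet (thickening ε.toReal B) := isOpen_thickening.measurableSet
  constructor
  · rw [Measure.map_apply hf₁ hB, Measure.map_apply hf₂ hthick]
    calc P₁ (f₁ ⁻¹' B) ≤ P₁ (Φ₁ ⁻¹' (Φ₁ '' (f₁ ⁻¹' B))) := measure_mono (subset_preimage_image _ _)
      _ ≤ P₂ (Φ₂ ⁻¹' (Φ₁ '' (f₁ ⁻¹' B))) + d := h₁₂ _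
      _ ≤ P₂ (f₂ ⁻¹' thickening ε.toReal B) + ε := by
          gcongr
          exact preimage_image_subset_preimage_thickening f₁ f₂ Φ₁ Φ₂ hclose hε₁ hεtop B
  · rw [Measure.map_apply hf₂ hB, Measure.map_apply hf₁ hthick]
    have hclose' : ∀ x₂ x₁, Φ₂ x₂ = Φ₁ x₁ → edist (f₂ x₂) (f₁ x₁) ≤ ε₁ := fun x₂ x₁ h => by
      rw [edist_comm]; exact hclose x₁ x₂ h.symm
    calc P₂ (f₂ ⁻¹' B) ≤ P₂ (Φ₂ ⁻¹' (Φ₂ '' (f₂ ⁻¹' B))) := measure_mono (subset_preimage_image _ _)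
      _ ≤ P₁ (Φ₁ ⁻¹' (Φ₂ '' (f₂ ⁻¹' B))) + d := h₂₁ _
      _ ≤ P₁ (f₁ ⁻¹' thickening ε.toReal B) + ε := by
          gcongr
          exact preimage_image_subset_preimage_thickening f₂ f₁ Φ₂ Φ₁ hclose' hε₁ hεtop B

end Summit.CriticalPhenomena.SAWScalingLimit.Theorems.ScreeningRecursion

end
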